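import Summits.Parity.GeneralizedHardyLittlewood.Theorems.PrimeLevelFamEdgeMomentsBeyondDiagonalDiagOrderSelberg
import Summits.Parity.GeneralizedHardyLittlewood.Theorems.PrimeLevelFamEdgeMomentsBeyondDiagonalDiagBoseOuter
import HarnessLib

/-!
# Route `PrimeLevelFamEdge`, crux K_A `MomentsBeyondDiagonal` (stmt-Parity-20007), line «petersson_layers» v4, stub `stub_diag`:
# **the decorated Selberg form is ADDITIVE in the weight, and the order-`(i,j)` form SPLITS EXACTLY into the Bose-coefficient
# pieces `(a,b)`** (first algebraic step of every per-order target of `…DiagOrderSelberg`)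

For the decorated Selberg form of `…DiagLineDecorated` (p817555),
`Sel(W) = Σ_{c≤N}Σ_{g≤N/c} μ(g)·c·Σ_{k₁,k₂≤N/(cg)} (x′_{cgk₁}/(cgk₁))(x′_{cgk₂}/(cgk₂)) Σ_{d∣k₁}Σ_{e∣k₂} W(n₁, n₂, n₁n₂)`,
`n₁ = (k₁/d)(ge)`, `n₂ = (gd)(k₂/e)`:
* `selbergForm_finset_sum` — `Sel(Σ_{t∈s} W_t) = Σ_{t∈s} Sel(W_t)` (finite additivity in the weight); `selbergForm_const_mul` —
  `Sel(κ·W) = κ·Sel(W)`;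
* `selbergForm_bose_expand` — **for the order-`(i,j)` Bose weight `W = 𝔚_{ij}(log(Q/n₁), log(Q/n₂); n₁n₂/Q²)` (`Q > 0`):
  `Sel(W) = Σ_{a≤i}Σ_{b≤j} Sel(W_{ab})`, `W_{ab}(n₁,n₂,K) = C(i,a)C(j,b)·(log(Q/n₁))^{i−a}(log(Q/n₂))^{j−b}·c_{ab}(K/Q²)`**,
  `c_{ab}(y) = ∫_{u₁>0}(log u₁)^a∫_{u₂>y/u₁} e^{−φ}(1−e^{−φ})^{−2}(log u₂)^b` (`…DiagBoseOuter.bose_expand`, p812352, termwise — every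
  `n₁n₂ ≥ 1`). This is an EXACT IDENTITY; the pieces `(a,b)` need not have individual asymptotics of order `q̂ℓ^{i+j−2}` (top degrees
  cancel across `(a,b)`), so the per-order TARGET stays at the level `(i,j)`.

Def-free; helper `--supports stmt-Parity-20007`; closes nothing; K_A, K_B and the Parity summit are NOT proved; nothing about
Landau–Siegel zeros.

## References
* E. Kowalski, P. Michel, J. VanderKam, J. reine angew. Math. 526 (2000), (21)–(28) pp. 12–15.
  [cite: KowalskiMichelVanderKam2000, (23)–(28) pp. 13–15 — derivation]
-/

noncomputable section

open scoped Real ArithmeticFunction.Moebius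
open MeasureTheory Polynomial Finset ArithmeticFunction
open Literature.NumberTheory.LFunctions

namespace Summit.Parity.GeneralizedHardyLittlewood.Theorems.MomentsBeyondDiagonal.DiagLines

/-- **Finite additivity of the decorated Selberg form in the weight**: `Sel(Σ_{t∈s} W_t) = Σ_{t∈s} Sel(W_t)`. [folklore] -/
theorem selbergForm_finset_sum {α : Type*} [DecidableEq α] (P : ℝ[X]) (M : ℝ) (N : ℕ) (s : Finset α)
    (W : α → ℕ → ℕ → ℕ → ℝ) :
    ∑ c ∈ Icc 1 N, ∑ g ∈ Icc 1 (N / c), (μ g : ℝ) * c *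
        ∑ k₁ ∈ Icc 1 (N / (c * g)), ∑ k₂ ∈ Icc 1 (N / (c * g)),
          ((μ (c * g * k₁) : ℝ) * ((KMV2000.psi (c * g * k₁))⁻¹ *
              P.eval (Real.log (M / ((c * g * k₁ : ℕ) : ℝ)) / Real.log M)) / ((c * g * k₁ : ℕ) : ℝ)) *
            ((μ (c * g * k₂) : ℝ) * ((KMV2000.psi (c * g * k₂))⁻¹ *
              P.eval (Real.log (M / ((c * g * k₂ : ℕ) : ℝ)) / Real.log M)) / ((c * g * k₂ : ℕ) : ℝ)) *
            ∑ d ∈ k₁.divisors, ∑ e ∈ k₂.divisors,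
              ∑ t ∈ s, W t (k₁ / d * (g * e)) (g * d * (k₂ / e)) (k₁ / d * (g * e) * (g * d * (k₂ / e))) =
      ∑ t ∈ s, ∑ c ∈ Icc 1 N, ∑ g ∈ Icc 1 (N / c), (μ g : ℝ) * c *
        ∑ k₁ ∈ Icc 1 (N / (c * g)), ∑ k₂ ∈ Icc 1 (N / (c * g)),
          ((μ (c * g * k₁) : ℝ) * ((KMV2000.psi (c * g * k₁))⁻¹ *
              P.eval (Real.log (M / ((c * g * k₁ : ℕ) : ℝ)) / Real.log M)) / ((c * g * k₁ : ℕ) : ℝ)) *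
            ((μ (c * g * k₂) : ℝ) * ((KMV2000.psi (c * g * k₂))⁻¹ *
              P.eval (Real.log (M / ((c * g * k₂ : ℕ) : ℝ)) / Real.log M)) / ((c * g * k₂ : ℕ) : ℝ)) *
            ∑ d ∈ k₁.divisors, ∑ e ∈ k₂.divisors,
              W t (k₁ / d * (g * e)) (g * d * (k₂ / e)) (k₁ / d * (g * e) * (g * d * (k₂ / e))) := by
  induction s using Finset.induction_on with
  | empty => simp
  | insert a s ha ih =>
    simp only [Finset.sum_insert ha]
    rw [← ih]
    simp only [Finset.sum_add_distrib, mul_add]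

/-- **The order-`(i,j)` decorated Selberg form splits exactly into its Bose-coefficient pieces** (`Q > 0`):
`Sel(𝔚_{ij}(log(Q/n₁), log(Q/n₂); n₁n₂/Q²)) = Σ_{a≤i}Σ_{b≤j} Sel(C(i,a)C(j,b)(log(Q/n₁))^{i−a}(log(Q/n₂))^{j−b} c_{ab}(n₁n₂/Q²))`.
[cite: KowalskiMichelVanderKam2000, (21)–(23) pp. 12–13 — derivation] -/
theorem selbergForm_bose_expand {Q : ℝ} (hQ : 0 < Q) (P : ℝ[X]) (M : ℝ) (N i j : ℕ) :
    ∑ c ∈ Icc 1 N, ∑ g ∈ Icc 1 (N / c), (μ g : ℝ) * c *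
        ∑ k₁ ∈ Icc 1 (N / (c * g)), ∑ k₂ ∈ Icc 1 (N / (c * g)),
          ((μ (c * g * k₁) : ℝ) * ((KMV2000.psi (c * g * k₁))⁻¹ *
              P.eval (Real.log (M / ((c * g * k₁ : ℕ) : ℝ)) / Real.log M)) / ((c * g * k₁ : ℕ) : ℝ)) *
            ((μ (c * g * k₂) : ℝ) * ((KMV2000.psi (c * g * k₂))⁻¹ *
              P.eval (Real.log (M / ((c * g * k₂ : ℕ) : ℝ)) / Real.log M)) / ((c * g * k₂ : ℕ) : ℝ)) *
            ∑ d ∈ k₁.divisors, ∑ e ∈ k₂.divisors,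
              ∫ u₁ in Set.Ioi (0 : ℝ),
                (Real.log (Q / ((k₁ / d * (g * e) : ℕ) : ℝ)) + Real.log u₁) ^ i *
                ∫ u₂ in Set.Ioi ((((k₁ / d * (g * e) * (g * d * (k₂ / e)) : ℕ) : ℝ) / Q ^ 2) / u₁),
                  Real.exp (-(u₁ + u₂)) / (1 - Real.exp (-(u₁ + u₂))) ^ 2 *
                  (Real.log (Q / ((g * d * (k₂ / e) : ℕ) : ℝ)) + Real.log u₂) ^ j =
      ∑ a ∈ Finset.range (i + 1), ∑ b ∈ Finset.range (j + 1),
        ∑ c ∈ Icc 1 N, ∑ g ∈ Icc 1 (N / c), (μ g : ℝ) * c *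
          ∑ k₁ ∈ Icc 1 (N / (c * g)), ∑ k₂ ∈ Icc 1 (N / (c * g)),
            ((μ (c * g * k₁) : ℝ) * ((KMV2000.psi (c * g * k₁))⁻¹ *
                P.eval (Real.log (M / ((c * g * k₁ : ℕ) : ℝ)) / Real.log M)) / ((c * g * k₁ : ℕ) : ℝ)) *
              ((μ (c * g * k₂) : ℝ) * ((KMV2000.psi (c * g * k₂))⁻¹ *
                P.eval (Real.log (M / ((c * g * k₂ : ℕ) : ℝ)) / Real.log M)) / ((c * g * k₂ : ℕ) : ℝ)) *
              ∑ d ∈ k₁.divisors, ∑ e ∈ k₂.divisors,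
                (i.choose a : ℝ) * (j.choose b : ℝ) * Real.log (Q / ((k₁ / d * (g * e) : ℕ) : ℝ)) ^ (i - a) *
                    Real.log (Q / ((g * d * (k₂ / e) : ℕ) : ℝ)) ^ (j - b) *
                  ∫ u₁ in Set.Ioi (0 : ℝ), Real.log u₁ ^ a *
                    ∫ u₂ in Set.Ioi ((((k₁ / d * (g * e) * (g * d * (k₂ / e)) : ℕ) : ℝ) / Q ^ 2) / u₁),
                      Real.exp (-(u₁ + u₂)) / (1 - Real.exp (-(u₁ + u₂))) ^ 2 * Real.log u₂ ^ b := by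
  -- Step 1: expand every innermost weight (all `n₁ n₂ ≥ 1`, so `y = n₁n₂/Q² > 0`)
  have hstep : ∀ c ∈ Icc 1 N, ∀ g ∈ Icc 1 (N / c), ∀ k₁ ∈ Icc 1 (N / (c * g)), ∀ k₂ ∈ Icc 1 (N / (c * g)),
      ∀ d ∈ k₁.divisors, ∀ e ∈ k₂.divisors,
      ∫ u₁ in Set.Ioi (0 : ℝ),
          (Real.log (Q / ((k₁ / d * (g * e) : ℕ) : ℝ)) + Real.log u₁) ^ i *
          ∫ u₂ in Set.Ioi ((((k₁ / d * (g * e) * (g * d * (k₂ / e)) : ℕ) : ℝ) / Q ^ 2) / u₁),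
            Real.exp (-(u₁ + u₂)) / (1 - Real.exp (-(u₁ + u₂))) ^ 2 *
            (Real.log (Q / ((g * d * (k₂ / e) : ℕ) : ℝ)) + Real.log u₂) ^ j =
        ∑ a ∈ Finset.range (i + 1), ∑ b ∈ Finset.range (j + 1),
          (i.choose a : ℝ) * (j.choose b : ℝ) * Real.log (Q / ((k₁ / d * (g * e) : ℕ) : ℝ)) ^ (i - a) *
              Real.log (Q / ((g * d * (k₂ / e) : ℕ) : ℝ)) ^ (j - b) *
            ∫ u₁ in Set.Ioi (0 : ℝ), Real.log u₁ ^ a *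
              ∫ u₂ in Set.Ioi ((((k₁ / d * (g * e) * (g * d * (k₂ / e)) : ℕ) : ℝ) / Q ^ 2) / u₁),
                Real.exp (-(u₁ + u₂)) / (1 - Real.exp (-(u₁ + u₂))) ^ 2 * Real.log u₂ ^ b := by
    intro c _ g hg k₁ hk₁ k₂ hk₂ d hd e he
    have hg1 : 1 ≤ g := (Finset.mem_Icc.mp hg).1
    have hk₁1 : 1 ≤ k₁ := (Finset.mem_Icc.mp hk₁).1
    have hk₂0 : k₂ ≠ 0 := by have := (Finset.mem_Icc.mp hk₂).1; omega
    have hdk : d ∣ k₁ := (Nat.mem_divisors.mp hd).1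
    have hek : e ∣ k₂ := (Nat.mem_divisors.mp he).1
    have hd0 : d ≠ 0 := fun h ↦ by simp [h] at hdk; omega
    have he0 : e ≠ 0 := fun h ↦ hk₂0 (Nat.eq_zero_of_zero_dvd (h ▸ hek))
    have h1 : k₁ / d ≠ 0 := fun h ↦ by have := Nat.eq_zero_of_dvd_of_div_eq_zero hdk h; omega
    have h2 : k₂ / e ≠ 0 := fun h ↦ hk₂0 (Nat.eq_zero_of_dvd_of_div_eq_zero hek h)
    have hK : (k₁ / d * (g * e) * (g * d * (k₂ / e))) ≠ 0 :=
      mul_ne_zero (mul_ne_zero h1 (mul_ne_zero (by omega) he0)) (mul_ne_zero (mul_ne_zero (by omega) hd0) h2)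
    have hy : 0 < (((k₁ / d * (g * e) * (g * d * (k₂ / e)) : ℕ) : ℝ) / Q ^ 2) := by
      have : (0 : ℝ) < ((k₁ / d * (g * e) * (g * d * (k₂ / e)) : ℕ) : ℝ) := by exact_mod_cast Nat.pos_of_ne_zero hK
      positivity
    exact bose_expand hy i j _ _
  rw [Finset.sum_congr rfl fun c hc ↦ Finset.sum_congr rfl fun g hg ↦ congrArg _
    (Finset.sum_congr rfl fun k₁ hk₁ ↦ Finset.sum_congr rfl fun k₂ hk₂ ↦ congrArg _
      (Finset.sum_congr rfl fun d hd ↦ Finset.sum_congr rfl fun e he ↦ hstep c hc g hg k₁ hk₁ k₂ hk₂ d hd e he))]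
  -- Step 2: additivity in `a`, then in `b`
  rw [selbergForm_finset_sum P M N (Finset.range (i + 1))
    (fun a n₁ n₂ K ↦ ∑ b ∈ Finset.range (j + 1),
      (i.choose a : ℝ) * (j.choose b : ℝ) * Real.log (Q / (n₁ : ℝ)) ^ (i - a) * Real.log (Q / (n₂ : ℝ)) ^ (j - b) *
        ∫ u₁ in Set.Ioi (0 : ℝ), Real.log u₁ ^ a *
          ∫ u₂ in Set.Ioi (((K : ℕ) : ℝ) / Q ^ 2 / u₁),
            Real.exp (-(u₁ + u₂)) / (1 - Real.exp (-(u₁ + u₂))) ^ 2 * Real.log u₂ ^ b)]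
  refine Finset.sum_congr rfl fun a _ ↦ ?_
  rw [selbergForm_finset_sum P M N (Finset.range (j + 1))
    (fun b n₁ n₂ K ↦
      (i.choose a : ℝ) * (j.choose b : ℝ) * Real.log (Q / (n₁ : ℝ)) ^ (i - a) * Real.log (Q / (n₂ : ℝ)) ^ (j - b) *
        ∫ u₁ in Set.Ioi (0 : ℝ), Real.log u₁ ^ a *
          ∫ u₂ in Set.Ioi (((K : ℕ) : ℝ) / Q ^ 2 / u₁),
            Real.exp (-(u₁ + u₂)) / (1 - Real.exp (-(u₁ + u₂))) ^ 2 * Real.log u₂ ^ b)]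

/-- **Homogeneity of the decorated Selberg form in the weight**: `Sel(κ·W) = κ·Sel(W)` (with `selbergForm_finset_sum` and
`selbergForm_bose_expand`: the binomial constants `C(i,a)C(j,b)` come out of each `(a,b)` piece). [folklore] -/
theorem selbergForm_const_mul (P : ℝ[X]) (M : ℝ) (N : ℕ) (κ : ℝ) (W : ℕ → ℕ → ℕ → ℝ) :
    ∑ c ∈ Icc 1 N, ∑ g ∈ Icc 1 (N / c), (μ g : ℝ) * c *
        ∑ k₁ ∈ Icc 1 (N / (c * g)), ∑ k₂ ∈ Icc 1 (N / (c * g)),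
          ((μ (c * g * k₁) : ℝ) * ((KMV2000.psi (c * g * k₁))⁻¹ *
              P.eval (Real.log (M / ((c * g * k₁ : ℕ) : ℝ)) / Real.log M)) / ((c * g * k₁ : ℕ) : ℝ)) *
            ((μ (c * g * k₂) : ℝ) * ((KMV2000.psi (c * g * k₂))⁻¹ *
              P.eval (Real.log (M / ((c * g * k₂ : ℕ) : ℝ)) / Real.log M)) / ((c * g * k₂ : ℕ) : ℝ)) *
            ∑ d ∈ k₁.divisors, ∑ e ∈ k₂.divisors,
              κ * W (k₁ / d * (g * e)) (g * d * (k₂ / e)) (k₁ / d * (g * e) * (g * d * (k₂ / e))) =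
      κ * ∑ c ∈ Icc 1 N, ∑ g ∈ Icc 1 (N / c), (μ g : ℝ) * c *
        ∑ k₁ ∈ Icc 1 (N / (c * g)), ∑ k₂ ∈ Icc 1 (N / (c * g)),
          ((μ (c * g * k₁) : ℝ) * ((KMV2000.psi (c * g * k₁))⁻¹ *
              P.eval (Real.log (M / ((c * g * k₁ : ℕ) : ℝ)) / Real.log M)) / ((c * g * k₁ : ℕ) : ℝ)) *
            ((μ (c * g * k₂) : ℝ) * ((KMV2000.psi (c * g * k₂))⁻¹ *
              P.eval (Real.log (M / ((c * g * k₂ : ℕ) : ℝ)) / Real.log M)) / ((c * g * k₂ : ℕ) : ℝ)) *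
            ∑ d ∈ k₁.divisors, ∑ e ∈ k₂.divisors,
              W (k₁ / d * (g * e)) (g * d * (k₂ / e)) (k₁ / d * (g * e) * (g * d * (k₂ / e))) := by
  simp only [Finset.mul_sum]
  refine Finset.sum_congr rfl fun c _ ↦ Finset.sum_congr rfl fun g _ ↦ Finset.sum_congr rfl fun k₁ _ ↦
    Finset.sum_congr rfl fun k₂ _ ↦ Finset.sum_congr rfl fun d _ ↦ Finset.sum_congr rfl fun e _ ↦ ?_
  ring

end Summit.Parity.GeneralizedHardyLittlewood.Theorems.MomentsBeyondDiagonal.DiagLines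

end
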